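import Literature.Analysis.FluidPDE.NSLocalAnalyticityRadiusLocalisedField
import Literature.Analysis.FluidPDE.DivPotentialHeatPairing
import Literature.Analysis.FluidPDE.MildSolutionProofs
import HarnessLib

/-!
# The commutator force of the localisation as a smooth family, and its projected version

Analysis/FluidPDE proofs-layer file (theorems only), module L3b of the proof of the named fact
`Literature.Analysis.FluidPDE.bradshawGrujicKukavica2015_local_analyticity_radius`
(Bradshaw–Grujić–Kukavica 2015, Thm. 2.3, §4). For a classical solution `(u, p)` on the open
cylinder `(-δ, R²) × B(x₁, R)` and an admissible cut-off `χ`, the localised fields of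
`NSLocalAnalyticityRadiusLocalisation.lean` are studied as **space–time families** on the open
time set `S = (-δ, R²)`:

* `isSmoothSpaceTimeOn_locVelocity`, `isSmoothSpaceTimeOn_locForce` — `v = χu` and
  `f₀ = (Δχ)u + (u·∇χ)u + p∇χ` are jointly smooth on `S × ℝ³` (cut-off gluing);
  `isSmoothSpaceTimeOn_divergence_locForce` — so is `div f₀`;
* uniform bounds on compact time intervals `[s₀, t₁] ⊆ S` for `v`, `f₀`, `div f₀`, `D div f₀`,
  for `u` on `[s₀, t₁] × B̄(x₁, R - 2)` and hence for the bounded extension `ũ`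
  (`exists_forall_norm_locExtension_le`), all by compactness;
* the projected force `P[f₀(s)] = f₀(s) - ∇π[f₀(s)]` (`locProjForce`): smooth and divergence
  free at each time, **jointly continuous on `S × ℝ³`** (`continuousOn_uncurry_locProjForce`:
  the gradient of the Newtonian potential of the divergence is a convolution of the locally
  integrable kernel `Γ` with the jointly continuous, uniformly compactly supported sources
  `∂ⱼ div f₀(s)`, Mathlib's `continuousOn_convolution_right_with_param`), and uniformly bounded
  on compact time intervals together with the potentials `π[f₀(s)]`
  (`exists_forall_norm_locProjForce_le`, `exists_forall_abs_divPotential_locForce_le`).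

These are the regularity inputs for the Duhamel forcing term `∫ e^{(t-s)Δ}P[f₀(s)] ds` and for
the Oseen representation of the localised field (next files).

## Mathlib / tree search

Tree: `IsSmoothSpaceTimeOn` and its algebra (`SpaceTimeCalculus`: `isSmoothSpaceTimeOn_fderiv_apply`,
`.smul`, `.clm`, `isSmoothSpaceTimeOn_const_time`); `divPotential_apply`,
`fderiv_convolution_newtonKernel_apply`, `convolution_newtonKernel_apply'`,
`NewtonPotentialRepresentation.locallyIntegrable_newtonKernel`, `abs_integral_newtonKernel_mul_le`,
`norm_fderiv_integral_newtonKernel_mul_le`; module L1. Mathlib: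
`continuousOn_convolution_right_with_param`, `convolution_lsmul`, `integral_sub_left_eq_self`,
`IsCompact.exists_bound_of_continuousOn`.

## References

* Z. Bradshaw, Z. Grujić, I. Kukavica, J. Differential Equations 259 (2015), §4, (4.2)–(4.3).
  [BradshawGrujicKukavica2015]
* D. Gilbarg, N. S. Trudinger, *Elliptic PDE of Second Order* (2001), Lemma 4.1.
  [GilbargTrudinger2001]
-/

noncomputable section

open MeasureTheory Set Function Filter Metric Real
open _root_.Topology
open scoped ENNReal ContDiff Laplacian InnerProductSpace RealInnerProductSpace Convolution

namespace Literature.Analysis.FluidPDE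

namespace BGK2015

variable {x₁ : EuclideanSpace ℝ (Fin 3)} {δ R : ℝ}
  {u : ℝ → EuclideanSpace ℝ (Fin 3) → EuclideanSpace ℝ (Fin 3)}
  {p : ℝ → EuclideanSpace ℝ (Fin 3) → ℝ} {χ : EuclideanSpace ℝ (Fin 3) → ℝ}

/-- The divergence of a compactly supported field has compact support (private copy of the tree's
`CalderonSplittingLp.hasCompactSupport_divergence`). [folklore] -/
private theorem hasCompactSupport_divergence_of_test
    {G : EuclideanSpace ℝ (Fin 3) → EuclideanSpace ℝ (Fin 3)} (hGc : HasCompactSupport G) :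
    HasCompactSupport (VectorCalculus.divergence G) :=
  hGc.mono' fun x hx => by
    by_contra h
    exact hx (divergence_eq_zero_of_notMem_tsupport h)

/-! ### Gluing in space–time -/

/-- **Space–time gluing**: a field which is `Cⁿ` on `S × B(x₁, R)` and vanishes at all points
`(s, x)` with `x` off the support of the cut-off (which lies in the open ball) is `Cⁿ` on
`S × ℝ³`. [folklore] -/
theorem contDiffOn_uncurry_of_eq_zero_off_tsupport (hχ : IsLocCutoff x₁ R χ) {n : WithTop ℕ∞}
    {X : Type*} [NormedAddCommGroup X] [NormedSpace ℝ X] {F : ℝ → EuclideanSpace ℝ (Fin 3) → X}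
    {S : Set ℝ} (hF : ContDiffOn ℝ n (uncurry F) (S ×ˢ ball x₁ R))
    (h0 : ∀ s x, x ∉ tsupport χ → F s x = 0) : ContDiffOn ℝ n (uncurry F) (S ×ˢ univ) := by
  intro z hz
  obtain ⟨hzt, -⟩ := hz
  by_cases hx : z.2 ∈ ball x₁ R
  · refine (hF z ⟨hzt, hx⟩).mono_of_mem_nhdsWithin ?_
    refine mem_nhdsWithin_iff_exists_mem_nhds_inter.2 ⟨univ ×ˢ ball x₁ R,
      prod_mem_nhds univ_mem (isOpen_ball.mem_nhds hx), ?_⟩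
    rintro w ⟨⟨-, hw2⟩, hw1, -⟩
    exact ⟨hw1, hw2⟩
  · have hxs := hχ.notMem_tsupport_of_notMem_ball hx
    have hopen : IsOpen ((tsupport χ)ᶜ : Set (EuclideanSpace ℝ (Fin 3))) :=
      (isClosed_tsupport χ).isOpen_compl
    have hev : uncurry F =ᶠ[𝓝 z] fun _ => 0 := by
      filter_upwards [(continuous_snd.isOpen_preimage _ hopen).mem_nhds hxs] with w hw
      exact h0 w.1 w.2 hw
    exact (contDiffAt_const.congr_of_eventuallyEq hev).contDiffWithinAt

/-- The divergence of a jointly smooth family is jointly smooth (on an open time set).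
[folklore] -/
theorem _root_.Literature.Analysis.FluidPDE.IsSmoothSpaceTimeOn.divergence {S : Set ℝ}
    (hS : IsOpen S) {w : ℝ → EuclideanSpace ℝ (Fin 3) → EuclideanSpace ℝ (Fin 3)}
    (hw : IsSmoothSpaceTimeOn S w) :
    IsSmoothSpaceTimeOn S fun t x => VectorCalculus.divergence (w t) x := by
  set b := stdOrthonormalBasis ℝ (EuclideanSpace ℝ (Fin 3)) with hb
  have h : ∀ i, IsSmoothSpaceTimeOn S fun t x => ⟪b i, fderiv ℝ (w t) x (b i)⟫ := fun i =>
    (isSmoothSpaceTimeOn_const_time contDiff_const S).inner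
      (hw.isSmoothSpaceTimeOn_fderiv_apply hS (b i))
  have hsum : ContDiffOn ℝ ∞ (fun z : ℝ × EuclideanSpace ℝ (Fin 3) =>
      ∑ i, uncurry (fun t x => ⟪b i, fderiv ℝ (w t) x (b i)⟫) z) (S ×ˢ univ) :=
    ContDiffOn.sum fun i _ => h i
  refine hsum.congr ?_
  rintro ⟨t, x⟩ -
  simp only [uncurry_apply_pair]
  exact divergence_eq_sum_inner_fderiv b (w t) x

/-! ### The localised fields as smooth space–time families -/

section Families

variable (hsol : IsCylinderSolution x₁ δ R u p) (hχ : IsLocCutoff x₁ R χ)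
include hsol hχ

/-- `v = χu` is jointly smooth on `(-δ, R²) × ℝ³`. [folklore] -/
theorem isSmoothSpaceTimeOn_locVelocity :
    IsSmoothSpaceTimeOn (Ioo (-δ) (R ^ 2)) (locVelocity χ u) :=
  contDiffOn_uncurry_locVelocity hsol hχ

/-- **`f₀` is jointly smooth on `(-δ, R²) × ℝ³`.** [folklore] -/
theorem isSmoothSpaceTimeOn_locForce :
    IsSmoothSpaceTimeOn (Ioo (-δ) (R ^ 2)) (locForce χ u p) := by
  have hu : ContDiffOn ℝ ∞ (uncurry u) (Ioo (-δ) (R ^ 2) ×ˢ ball x₁ R) := hsol.smooth_velocity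
  have hp : ContDiffOn ℝ ∞ (uncurry p) (Ioo (-δ) (R ^ 2) ×ˢ ball x₁ R) := hsol.smooth_pressure
  have hΔχ : ContDiff ℝ ∞ (Δ χ) := contDiff_laplacian (n := (⊤ : ℕ∞)) (by exact_mod_cast hχ.contDiff)
  have h1 : ContDiffOn ℝ ∞ (fun z : ℝ × EuclideanSpace ℝ (Fin 3) => (Δ χ) z.2 • u z.1 z.2)
      (Ioo (-δ) (R ^ 2) ×ˢ ball x₁ R) :=
    (hΔχ.comp contDiff_snd).contDiffOn.smul hu
  have h2 : ContDiffOn ℝ ∞ (fun z : ℝ × EuclideanSpace ℝ (Fin 3) =>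
      (fderiv ℝ χ z.2 (u z.1 z.2)) • u z.1 z.2) (Ioo (-δ) (R ^ 2) ×ˢ ball x₁ R) :=
    (((hχ.contDiff.fderiv_right (m := ∞) le_rfl).comp contDiff_snd).contDiffOn.clm_apply hu).smul
      hu
  have h3 : ContDiffOn ℝ ∞ (fun z : ℝ × EuclideanSpace ℝ (Fin 3) => p z.1 z.2 • gradient χ z.2)
      (Ioo (-δ) (R ^ 2) ×ˢ ball x₁ R) :=
    hp.smul ((contDiff_gradient_of_contDiff_top hχ.contDiff).comp contDiff_snd).contDiffOn
  refine contDiffOn_uncurry_of_eq_zero_off_tsupport hχ (((h1.add h2).add h3).congr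
    fun z _ => by simp [uncurry, locForce_apply]) fun s x hx => ?_
  obtain ⟨-, hD0, hg0, hΔ0⟩ := (hχ.eventually_derivs_eq_zero hx).self_of_nhds
  simp [locForce_apply, hD0, hg0, hΔ0]

/-- **`div f₀` is jointly smooth on `(-δ, R²) × ℝ³`.** [folklore] -/
theorem isSmoothSpaceTimeOn_divergence_locForce :
    IsSmoothSpaceTimeOn (Ioo (-δ) (R ^ 2)) fun s x => VectorCalculus.divergence (locForce χ u p s) x :=
  (isSmoothSpaceTimeOn_locForce hsol hχ).divergence isOpen_Ioo

end Families

/-! ### Uniform bounds on compact time intervals -/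

/-- **Compactness bound for a family with uniformly compact spatial support**: a field continuous
on `S × ℝ³`, vanishing for `x` off a compact `K`, is bounded on `[s₀, t₁] × ℝ³` whenever
`[s₀, t₁] ⊆ S`. [folklore] -/
theorem exists_forall_norm_le_of_support {X : Type*} [NormedAddCommGroup X]
    {F : ℝ → EuclideanSpace ℝ (Fin 3) → X} {S : Set ℝ} {s₀ t₁ : ℝ} (hI : Icc s₀ t₁ ⊆ S)
    (hF : ContinuousOn (uncurry F) (S ×ˢ univ)) {K : Set (EuclideanSpace ℝ (Fin 3))}
    (hK : IsCompact K) (h0 : ∀ s x, x ∉ K → F s x = 0) :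
    ∃ C : ℝ, 0 ≤ C ∧ ∀ s ∈ Icc s₀ t₁, ∀ x, ‖F s x‖ ≤ C := by
  obtain ⟨C, hC⟩ := (isCompact_Icc.prod hK).exists_bound_of_continuousOn
    (hF.mono (prod_mono hI (subset_univ _)))
  refine ⟨max C 0, le_max_right _ _, fun s hs x => ?_⟩
  by_cases hx : x ∈ K
  · exact (hC (s, x) ⟨hs, hx⟩).trans (le_max_left _ _)
  · rw [h0 s x hx, norm_zero]
    exact le_max_right _ _

section Bounds

variable (hsol : IsCylinderSolution x₁ δ R u p) (hχ : IsLocCutoff x₁ R χ) {s₀ t₁ : ℝ}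
  (hI : Icc s₀ t₁ ⊆ Ioo (-δ) (R ^ 2))
include hsol hχ hI

/-- `v` is bounded on `[s₀, t₁] × ℝ³`. [folklore] -/
theorem exists_forall_norm_locVelocity_le :
    ∃ C : ℝ, 0 ≤ C ∧ ∀ s ∈ Icc s₀ t₁, ∀ x, ‖locVelocity χ u s x‖ ≤ C :=
  exists_forall_norm_le_of_support hI (isSmoothSpaceTimeOn_locVelocity hsol hχ).continuousOn
    (isCompact_closedBall x₁ (R - 3)) fun s _ hx =>
      locVelocity_eq_zero_of_notMem (fun h => hx (hχ.tsupport_subset h)) u s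

/-- `f₀` is bounded on `[s₀, t₁] × ℝ³`. [folklore] -/
theorem exists_forall_norm_locForce_le :
    ∃ C : ℝ, 0 ≤ C ∧ ∀ s ∈ Icc s₀ t₁, ∀ x, ‖locForce χ u p s x‖ ≤ C := by
  refine exists_forall_norm_le_of_support hI (isSmoothSpaceTimeOn_locForce hsol hχ).continuousOn
    (isCompact_closedBall x₁ (R - 3)) fun s x hx => ?_
  have : x ∉ tsupport (locForce χ u p s) := fun h => hx (tsupport_locForce_subset hχ h)
  exact image_eq_zero_of_notMem_tsupport this

omit hχ in
/-- **`u` is bounded on `[s₀, t₁] × B̄(x₁, R - 2)`** (a compact subset of the open cylinder).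
[folklore] -/
theorem exists_forall_norm_velocity_le :
    ∃ M : ℝ, 0 ≤ M ∧ ∀ s ∈ Icc s₀ t₁, ∀ x ∈ closedBall x₁ (R - 2), ‖u s x‖ ≤ M := by
  have hsub : Icc s₀ t₁ ×ˢ closedBall x₁ (R - 2) ⊆ Ioo (-δ) (R ^ 2) ×ˢ ball x₁ R :=
    prod_mono hI (closedBall_subset_ball (by linarith))
  obtain ⟨M, hM⟩ := (isCompact_Icc.prod (isCompact_closedBall x₁ (R - 2))).exists_bound_of_continuousOn
    (hsol.continuousOn_velocity.mono hsub)
  exact ⟨max M 0, le_max_right _ _, fun s hs x hx => (hM (s, x) ⟨hs, hx⟩).trans (le_max_left _ _)⟩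

omit hχ in
/-- **The bounded extension is bounded on `[s₀, t₁] × ℝ³`.** [folklore] -/
theorem exists_forall_norm_locExtension_le :
    ∃ M : ℝ, 0 ≤ M ∧ ∀ s ∈ Icc s₀ t₁, ∀ x, ‖locExtension x₁ R u s x‖ ≤ M := by
  obtain ⟨M, hM0, hM⟩ := exists_forall_norm_velocity_le hsol hI
  refine ⟨M, hM0, fun s hs x => ?_⟩
  by_cases hx : x ∈ ball x₁ (R - 2)
  · rw [locExtension_of_mem hx]
    exact hM s hs x (ball_subset_closedBall hx)
  · rw [locExtension_of_notMem hx, norm_zero]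
    exact hM0

/-- `div f₀` is bounded on `[s₀, t₁] × ℝ³`. [folklore] -/
theorem exists_forall_norm_divergence_locForce_le :
    ∃ C : ℝ, 0 ≤ C ∧ ∀ s ∈ Icc s₀ t₁, ∀ x, ‖VectorCalculus.divergence (locForce χ u p s) x‖ ≤ C := by
  refine exists_forall_norm_le_of_support hI
    (isSmoothSpaceTimeOn_divergence_locForce hsol hχ).continuousOn (isCompact_closedBall x₁ (R - 3))
    fun s x hx => ?_
  have : x ∉ tsupport (locForce χ u p s) := fun h => hx (tsupport_locForce_subset hχ h)
  exact divergence_eq_zero_of_notMem_tsupport this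

/-- `D div f₀` is bounded on `[s₀, t₁] × ℝ³`. [folklore] -/
theorem exists_forall_norm_fderiv_divergence_locForce_le :
    ∃ C : ℝ, 0 ≤ C ∧ ∀ s ∈ Icc s₀ t₁, ∀ x,
      ‖fderiv ℝ (VectorCalculus.divergence (locForce χ u p s)) x‖ ≤ C := by
  have hsm := (isSmoothSpaceTimeOn_divergence_locForce hsol hχ).isSmoothSpaceTimeOn_fderiv_of_isOpen
    isOpen_Ioo
  refine exists_forall_norm_le_of_support hI hsm.continuousOn (isCompact_closedBall x₁ (R - 3))
    fun s x hx => ?_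
  have hsub : tsupport (VectorCalculus.divergence (locForce χ u p s)) ⊆ tsupport (locForce χ u p s) :=
    closure_minimal (fun y hy => by
      by_contra h'; exact hy (divergence_eq_zero_of_notMem_tsupport h')) (isClosed_tsupport _)
  have hx' : x ∉ tsupport (VectorCalculus.divergence (locForce χ u p s)) := fun h =>
    hx (tsupport_locForce_subset hχ (hsub h))
  exact fderiv_of_notMem_tsupport ℝ hx'

end Bounds

/-! ### The projected commutator force -/

/-- **Commutativity of the Newtonian convolution**: `(h ⋆ Γ)(y) = (Γ ⋆ h)(y)` (substitution
`t ↦ y - t`). [folklore] -/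
theorem convolution_newtonKernel_comm (h : EuclideanSpace ℝ (Fin 3) → ℝ) (y : EuclideanSpace ℝ (Fin 3)) :
    (h ⋆[ContinuousLinearMap.lsmul ℝ ℝ, volume] newtonKernel) y =
      (newtonKernel ⋆[ContinuousLinearMap.lsmul ℝ ℝ, volume] h) y := by
  rw [convolution_newtonKernel_apply', convolution_lsmul]
  simp only [smul_eq_mul]
  have e := integral_sub_left_eq_self (fun t => newtonKernel t * h (y - t)) volume y
  simp only [sub_sub_cancel] at e
  exact e

/-- **Joint continuity of gradient potentials with a parameter**: if `g : ℝ → ℝ³ → ℝ` is jointly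
continuous on `S × ℝ³` and supported in a fixed compact `K`, then
`(s, y) ↦ (g(s) ⋆ Γ)(y)` is jointly continuous on `S × ℝ³` (`Γ ∈ L¹_loc`; Mathlib's
`continuousOn_convolution_right_with_param`). [folklore] -/
theorem continuousOn_convolution_newtonKernel_param {S : Set ℝ} {g : ℝ → EuclideanSpace ℝ (Fin 3) → ℝ}
    {K : Set (EuclideanSpace ℝ (Fin 3))} (hK : IsCompact K)
    (hg : ContinuousOn (uncurry g) (S ×ˢ univ)) (h0 : ∀ s x, x ∉ K → g s x = 0) :
    ContinuousOn (fun q : ℝ × EuclideanSpace ℝ (Fin 3) =>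
      (g q.1 ⋆[ContinuousLinearMap.lsmul ℝ ℝ, volume] newtonKernel) q.2) (S ×ˢ univ) := by
  have h := continuousOn_convolution_right_with_param (ContinuousLinearMap.lsmul ℝ ℝ)
    (μ := (volume : Measure (EuclideanSpace ℝ (Fin 3)))) (f := newtonKernel) (g := g) (s := S)
    hK (fun s x _ hx => h0 s x hx) NewtonPotentialRepresentation.locallyIntegrable_newtonKernel hg
  refine h.congr fun q _ => ?_
  exact convolution_newtonKernel_comm (g q.1) q.2

section ProjForce

variable (hsol : IsCylinderSolution x₁ δ R u p) (hχ : IsLocCutoff x₁ R χ)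
include hsol hχ

/-- `P[f₀(s)] ∈ C^∞` for `s ∈ (-δ, R²)`. [folklore] -/
theorem contDiff_locProjForce {s : ℝ} (hs : s ∈ Ioo (-δ) (R ^ 2)) :
    ContDiff ℝ ∞ (locProjForce χ u p s) :=
  contDiff_classicalLerayProj (contDiff_locForce hsol hχ hs) (hasCompactSupport_locForce hχ)

/-- **`div P[f₀(s)] = 0`.** [cite: MajdaBertozziCUP2002, §1.8 Prop. 1.16 (1.91)] -/
theorem isDivFree_locProjForce {s : ℝ} (hs : s ∈ Ioo (-δ) (R ^ 2)) :
    VectorCalculus.IsDivFree (locProjForce χ u p s) :=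
  isDivFree_classicalLerayProj (contDiff_locForce hsol hχ hs) (hasCompactSupport_locForce hχ)

/-- The directional derivatives of the potentials `π[f₀(s)]` are jointly continuous in `(s, y)`
on `(-δ, R²) × ℝ³`. [folklore] -/
theorem continuousOn_fderiv_divPotential_locForce (a : EuclideanSpace ℝ (Fin 3)) :
    ContinuousOn (fun q : ℝ × EuclideanSpace ℝ (Fin 3) =>
      fderiv ℝ (divPotential (locForce χ u p q.1)) q.2 a) (Ioo (-δ) (R ^ 2) ×ˢ univ) := by
  set g : ℝ → EuclideanSpace ℝ (Fin 3) → ℝ := fun s t =>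
    fderiv ℝ (VectorCalculus.divergence (locForce χ u p s)) t a with hgdef
  have hgsm : IsSmoothSpaceTimeOn (Ioo (-δ) (R ^ 2)) g :=
    (isSmoothSpaceTimeOn_divergence_locForce hsol hχ).isSmoothSpaceTimeOn_fderiv_apply isOpen_Ioo a
  have hg0 : ∀ s x, x ∉ closedBall x₁ (R - 3) → g s x = 0 := by
    intro s x hx
    have hsub : tsupport (VectorCalculus.divergence (locForce χ u p s)) ⊆ tsupport (locForce χ u p s) :=
      closure_minimal (fun y hy => by
        by_contra h'; exact hy (divergence_eq_zero_of_notMem_tsupport h')) (isClosed_tsupport _)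
    have hx' : x ∉ tsupport (VectorCalculus.divergence (locForce χ u p s)) := fun h =>
      hx (tsupport_locForce_subset hχ (hsub h))
    simp [hgdef, fderiv_of_notMem_tsupport ℝ hx']
  have hconv := continuousOn_convolution_newtonKernel_param (isCompact_closedBall x₁ (R - 3))
    hgsm.continuousOn hg0
  refine hconv.congr ?_
  rintro ⟨s, y⟩ ⟨hs, -⟩
  have hd : ContDiff ℝ ∞ (VectorCalculus.divergence (locForce χ u p s)) :=
    contDiff_divergence_of_contDiff_top (contDiff_locForce hsol hχ hs)
  have hdc : HasCompactSupport (VectorCalculus.divergence (locForce χ u p s)) :=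
    hasCompactSupport_divergence_of_test (hasCompactSupport_locForce hχ)
  show fderiv ℝ (divPotential (locForce χ u p s)) y a =
    (g s ⋆[ContinuousLinearMap.lsmul ℝ ℝ, volume] newtonKernel) y
  rw [divPotential, fderiv_convolution_newtonKernel_apply (hd.of_le (by norm_cast)) hdc]

/-- The gradients `∇π[f₀(s)](y)` are jointly continuous in `(s, y)` on `(-δ, R²) × ℝ³`.
[folklore] -/
theorem continuousOn_gradient_divPotential_locForce :
    ContinuousOn (fun q : ℝ × EuclideanSpace ℝ (Fin 3) =>
      gradient (divPotential (locForce χ u p q.1)) q.2) (Ioo (-δ) (R ^ 2) ×ˢ univ) := by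
  set b := EuclideanSpace.basisFun (Fin 3) ℝ with hb
  have hexp : ∀ q : ℝ × EuclideanSpace ℝ (Fin 3), gradient (divPotential (locForce χ u p q.1)) q.2 =
      ∑ j, (fderiv ℝ (divPotential (locForce χ u p q.1)) q.2 (b j)) • b j := by
    intro q
    conv_lhs => rw [← b.sum_repr' (gradient (divPotential (locForce χ u p q.1)) q.2)]
    refine Finset.sum_congr rfl fun j _ => ?_
    rw [real_inner_comm, gradient, InnerProductSpace.toDual_symm_apply]
  have h : ContinuousOn (fun q : ℝ × EuclideanSpace ℝ (Fin 3) =>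
      ∑ j, (fderiv ℝ (divPotential (locForce χ u p q.1)) q.2 (b j)) • b j)
      (Ioo (-δ) (R ^ 2) ×ˢ univ) :=
    continuousOn_finsetSum _ fun j _ =>
      (continuousOn_fderiv_divPotential_locForce hsol hχ (b j)).smul continuousOn_const
  exact h.congr fun q _ => hexp q

/-- **`(s, y) ↦ P[f₀(s)](y)` is jointly continuous on `(-δ, R²) × ℝ³`.** [folklore] -/
theorem continuousOn_uncurry_locProjForce :
    ContinuousOn (uncurry (locProjForce χ u p)) (Ioo (-δ) (R ^ 2) ×ˢ univ) := by
  have h1 := (isSmoothSpaceTimeOn_locForce hsol hχ).continuousOn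
  have h2 := continuousOn_gradient_divPotential_locForce hsol hχ
  exact (h1.sub h2).congr fun q _ => by simp [uncurry, locProjForce_apply]

variable {s₀ t₁ : ℝ} (hI : Icc s₀ t₁ ⊆ Ioo (-δ) (R ^ 2))
include hI

/-- The `L¹` norms of `div f₀(s)` and of `D div f₀(s)` are bounded on `[s₀, t₁]`. [folklore] -/
theorem exists_forall_integral_divergence_locForce_le :
    ∃ A : ℝ, 0 ≤ A ∧ (∀ s ∈ Icc s₀ t₁, ∫ x, |VectorCalculus.divergence (locForce χ u p s) x| ≤ A) ∧
      ∀ s ∈ Icc s₀ t₁, ∫ x, ‖fderiv ℝ (VectorCalculus.divergence (locForce χ u p s)) x‖ ≤ A := by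
  obtain ⟨C, hC0, hC⟩ := exists_forall_norm_divergence_locForce_le hsol hχ hI
  obtain ⟨C', hC0', hC'⟩ := exists_forall_norm_fderiv_divergence_locForce_le hsol hχ hI
  set K : Set (EuclideanSpace ℝ (Fin 3)) := closedBall x₁ (R - 3) with hK
  have hKvol : volume K < (⊤ : ℝ≥0∞) := (isCompact_closedBall x₁ (R - 3)).measure_lt_top
  have hsuppd : ∀ s, tsupport (VectorCalculus.divergence (locForce χ u p s)) ⊆ K := fun s =>
    (closure_minimal (fun y hy => by
      by_contra h'; exact hy (divergence_eq_zero_of_notMem_tsupport h')) (isClosed_tsupport _)).trans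
      (tsupport_locForce_subset hχ)
  refine ⟨max C C' * (volume K).toReal, by positivity, fun s hs => ?_, fun s hs => ?_⟩
  · have h0 : ∀ x ∉ K, |VectorCalculus.divergence (locForce χ u p s) x| = 0 := fun x hx => by
      rw [image_eq_zero_of_notMem_tsupport fun h => hx (hsuppd s h), abs_zero]
    rw [← setIntegral_eq_integral_of_forall_compl_eq_zero h0]
    calc ∫ x in K, |VectorCalculus.divergence (locForce χ u p s) x|
        ≤ ∫ _ in K, max C C' := by
          refine setIntegral_mono_on ?_ (integrableOn_const hKvol.ne) measurableSet_closedBall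
            fun x _ => (Real.norm_eq_abs _ ▸ hC s hs x).trans (le_max_left _ _)
          exact ((contDiff_divergence_of_contDiff_top (contDiff_locForce hsol hχ (hI hs))).continuous.abs
            ).continuousOn.integrableOn_compact (isCompact_closedBall _ _)
      _ = max C C' * (volume K).toReal := by
          rw [setIntegral_const, smul_eq_mul, mul_comm]; rfl
  · have h0 : ∀ x ∉ K, ‖fderiv ℝ (VectorCalculus.divergence (locForce χ u p s)) x‖ = 0 := fun x hx => by
      rw [fderiv_of_notMem_tsupport ℝ fun h => hx (hsuppd s h), norm_zero]
    rw [← setIntegral_eq_integral_of_forall_compl_eq_zero h0]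
    calc ∫ x in K, ‖fderiv ℝ (VectorCalculus.divergence (locForce χ u p s)) x‖
        ≤ ∫ _ in K, max C C' := by
          refine setIntegral_mono_on ?_ (integrableOn_const hKvol.ne) measurableSet_closedBall
            fun x _ => (hC' s hs x).trans (le_max_right _ _)
          have hd1 : ContDiff ℝ 1 (VectorCalculus.divergence (locForce χ u p s)) :=
            (contDiff_divergence_of_contDiff_top (contDiff_locForce hsol hχ (hI hs))).of_le (by norm_cast)
          exact ((hd1.continuous_fderiv one_ne_zero).norm).continuousOn.integrableOn_compact
            (isCompact_closedBall _ _)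
      _ = max C C' * (volume K).toReal := by
          rw [setIntegral_const, smul_eq_mul, mul_comm]; rfl

/-- **The potentials `π[f₀(s)]` are uniformly bounded on `[s₀, t₁] × ℝ³`.** [folklore] -/
theorem exists_forall_abs_divPotential_locForce_le :
    ∃ C : ℝ, ∀ s ∈ Icc s₀ t₁, ∀ y, |divPotential (locForce χ u p s) y| ≤ C := by
  obtain ⟨B, _, hB⟩ := exists_forall_norm_divergence_locForce_le hsol hχ hI
  obtain ⟨A, _, hA, -⟩ := exists_forall_integral_divergence_locForce_le hsol hχ hI
  refine ⟨B + (4 * Real.pi)⁻¹ * A, fun s hs y => ?_⟩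
  have hd : Continuous (VectorCalculus.divergence (locForce χ u p s)) :=
    (contDiff_divergence_of_contDiff_top (contDiff_locForce hsol hχ (hI hs))).continuous
  have hdc := hasCompactSupport_divergence_of_test (hasCompactSupport_locForce hχ (u := u) (p := p) (t := s))
  rw [divPotential_apply]
  refine (abs_integral_newtonKernel_mul_le hd hdc
    (fun x => (Real.norm_eq_abs _).symm.le.trans (hB s hs x)) y).trans ?_
  gcongr
  exact hA s hs

/-- **The gradients `∇π[f₀(s)]` are uniformly bounded on `[s₀, t₁] × ℝ³`.** [folklore] -/
theorem exists_forall_norm_gradient_divPotential_locForce_le :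
    ∃ C : ℝ, 0 ≤ C ∧ ∀ s ∈ Icc s₀ t₁, ∀ y, ‖gradient (divPotential (locForce χ u p s)) y‖ ≤ C := by
  obtain ⟨B₁, hB₁0, hB₁⟩ := exists_forall_norm_fderiv_divergence_locForce_le hsol hχ hI
  obtain ⟨A, hA0, -, hA⟩ := exists_forall_integral_divergence_locForce_le hsol hχ hI
  refine ⟨B₁ + (4 * Real.pi)⁻¹ * A, by positivity, fun s hs y => ?_⟩
  have hd : ContDiff ℝ ∞ (VectorCalculus.divergence (locForce χ u p s)) :=
    contDiff_divergence_of_contDiff_top (contDiff_locForce hsol hχ (hI hs))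
  have hdc := hasCompactSupport_divergence_of_test (hasCompactSupport_locForce hχ (u := u) (p := p) (t := s))
  have h := norm_fderiv_integral_newtonKernel_mul_le hd hdc (hB₁ s hs) y
  rw [← divPotential_eq_integral] at h
  rw [show ‖gradient (divPotential (locForce χ u p s)) y‖ =
      ‖fderiv ℝ (divPotential (locForce χ u p s)) y‖ by rw [gradient, LinearIsometryEquiv.norm_map]]
  refine h.trans ?_
  gcongr
  exact hA s hs

/-- **`P[f₀(s)]` is uniformly bounded on `[s₀, t₁] × ℝ³`.** [folklore] -/
theorem exists_forall_norm_locProjForce_le :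
    ∃ C : ℝ, 0 ≤ C ∧ ∀ s ∈ Icc s₀ t₁, ∀ y, ‖locProjForce χ u p s y‖ ≤ C := by
  obtain ⟨C₁, hC₁0, hC₁⟩ := exists_forall_norm_locForce_le hsol hχ hI
  obtain ⟨C₂, hC₂0, hC₂⟩ := exists_forall_norm_gradient_divPotential_locForce_le hsol hχ hI
  refine ⟨C₁ + C₂, by positivity, fun s hs y => ?_⟩
  rw [locProjForce_apply]
  exact (norm_sub_le _ _).trans (add_le_add (hC₁ s hs y) (hC₂ s hs y))

end ProjForce

end BGK2015

end Literature.Analysis.FluidPDE
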